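import Summits.CriticalPhenomena.PercolationContinuityZ3.Theorems.PercNearOneGluingNoHeavyLowerTailSahiSlotPinnedCharge

/-!
# The slot-pattern kernel with a pinned slot, III: the ZERO LOCUS of the charge on the meet — every order `n ≥ 2`, every dimension `d`

Support file of the one-cut programme (crux `NoHeavyLowerTail`, stmt-CriticalPhenomena-4575; cell `prim-masterthm`, seat P3, gen 29; `HIERARCHY.md` §36).
Sequel of `…SahiSlotPinnedCharge` (top-cell identity `pinned_eq_topCell`, `pinned_nonneg_of_mem`, `pinned_mono_of_mem`).  The order-3 statement is
prim-master-conj's `SahiLatin.Phi_eq_zero_iff_of_mem` (gen 43: `Φ_bc(u) = 0 ⟺ link u ⊆ b ∩ c` for `u ∈ b ∩ c`); here, every order: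

* **`pinned_eq_zero_iff_of_mem`**: for `m ∈ ⋂_i a_i` (arbitrary finite sets `a_i ⊆ [N+2]^d`),
  `charge_a(m) = 0 ⟺` the whole LINK of `m` lies in every `a_i`, i.e. `∀ q ∈ [N+1]^d, ∀ i, ι_m(q) ∈ a_i` with `ι_m(q) = (m_a.succAbove q_a)_a`
  (⇐: every factor of the top-cell form is `1 − 1`; ⇒: all terms vanish, read the term of an `(N+1)`-CYCLE `ρ` — one cycle, representative `0` — at a Latin tuple
  whose first point is `q`: it is `1 − Π_i [ι_m(q) ∈ a_i]`);
* `pinned_pos_iff_of_mem` (the complement: the charge is STRICTLY positive iff some link point misses some `a_i`);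
* `pinned_eq_zero_of_le` (up-sets: the zero set of the charge on the meet is a down-set of the meet).
No definitions; everything proved; axioms standard. [this work]
-/

noncomputable section

namespace Summit.CriticalPhenomena.PercolationContinuityZ3.Theorems

open Finset Function Equiv Equiv.Perm
open Literature.Combinatorics.Sahi2008 Literature.Combinatorics.Sahi2008.CycleForm

namespace SahiSlot

variable {d N : ℕ}

/-- Every `Fin (N+1)` carries a permutation with a single cycle. [folklore] -/
theorem exists_forall_sameCycle (N : ℕ) : ∃ ρ : Perm (Fin (N + 1)), ∀ a b, SameCycle ρ a b := by
  cases N with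
  | zero =>
    refine ⟨1, fun a b => ?_⟩
    have hab : a = b := Fin.ext (by have := a.isLt; have := b.isLt; omega)
    rw [hab]
  | succ k =>
    refine ⟨finRotate (k + 2), fun a b => (isCycle_finRotate (n := k)).sameCycle ?_ ?_⟩
    · exact mem_support.1 (by rw [support_finRotate]; exact mem_univ a)
    · exact mem_support.1 (by rw [support_finRotate]; exact mem_univ b)

/-- For a one-cycle permutation every representative is `0`. [this work] -/
theorem rep_eq_zero_of_forall_sameCycle {ρ : Perm (Fin (N + 1))} (h : ∀ a b, SameCycle ρ a b) (i : Fin (N + 1)) : rep ρ i = 0 :=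
  rep_eq_of_mem_of_le (mem_orbit.2 (h i 0)) fun y _ => Fin.zero_le y

/-- … and its set of cycles is `{everything}`. [this work] -/
theorem orbits_eq_singleton_univ_of_forall_sameCycle {ρ : Perm (Fin (N + 1))} (h : ∀ a b, SameCycle ρ a b) :
    orbits ρ = {(univ : Finset (Fin (N + 1)))} := by
  have hu : orbit ρ 0 = univ := eq_univ_iff_forall.2 fun i => mem_orbit.2 (h 0 i)
  unfold orbits
  ext c
  simp only [mem_image, mem_univ, true_and, mem_singleton]
  constructor
  · rintro ⟨x, rfl⟩
    rw [← hu]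
    exact orbit_eq_orbit_of_sameCycle (h x 0)
  · rintro rfl
    exact ⟨0, hu⟩

/-- A product of indicator values is `1` only if every factor is. [folklore] -/
theorem mem_of_prod_setInd_eq_one {X : Type*} [DecidableEq X] {ι : Type*} {s : Finset ι} {A : ι → Finset X} {x : ι → X}
    (h : ∏ i ∈ s, setInd (A i) (x i) = 1) {i : ι} (hi : i ∈ s) : x i ∈ A i := by
  by_contra hx
  have h0 : ∏ i ∈ s, setInd (A i) (x i) = 0 := prod_eq_zero hi (by rw [setInd_apply, if_neg hx])
  rw [h0] at h
  exact zero_ne_one h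

/-- **ZERO LOCUS OF THE CHARGE ON THE MEET, every order**: for `m ∈ ⋂ a_i` the pinned kernel vanishes iff the whole link of `m` lies in every `a_i`. [this work] -/
theorem pinned_eq_zero_iff_of_mem (a : Fin (N + 1) → Finset (Q d (N + 2))) {m : Q d (N + 2)} (hm : ∀ i, m ∈ a i) :
    patternForm d (N + 2) (Fin.cons (setInd {m}) (fun i => setInd (a i)) : Fin (N + 2) → Q d (N + 2) → ℝ) = 0 ↔
      ∀ (q : Q d (N + 1)) (i : Fin (N + 1)), (fun ax => (m ax).succAbove (q ax)) ∈ a i := by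
  rw [pinned_eq_topCell a hm]
  constructor
  · intro h0 q i
    -- all terms vanish; read the term of a one-cycle `ρ` at a Latin tuple with first point `q`
    have hτ : ∀ τ' : Fin d → Perm (Fin (N + 1)), ∑ ρ : Perm (Fin (N + 1)), ∏ c ∈ orbits ρ,
        (1 - ∏ i ∈ c, setInd (a i) (fun ax => (m ax).succAbove (act τ' (diag (rep ρ i)) ax))) = 0 := by
      intro τ'
      refine (sum_eq_zero_iff_of_nonneg fun τ'' _ => ?_).1 h0 τ' (mem_univ _)
      exact sum_nonneg fun ρ _ => prod_nonneg fun c _ => sub_nonneg.2 (prod_setInd_le_one _ _ _)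
    obtain ⟨ρ, hρ⟩ := exists_forall_sameCycle N
    set τ' : Fin d → Perm (Fin (N + 1)) := fun ax => Equiv.swap 0 (q ax) with hτ'
    have hterm : ∏ c ∈ orbits ρ, (1 - ∏ i ∈ c, setInd (a i) (fun ax => (m ax).succAbove (act τ' (diag (rep ρ i)) ax))) = 0 := by
      refine (sum_eq_zero_iff_of_nonneg fun ρ' _ => ?_).1 (hτ τ') ρ (mem_univ _)
      exact prod_nonneg fun c _ => sub_nonneg.2 (prod_setInd_le_one _ _ _)
    rw [orbits_eq_singleton_univ_of_forall_sameCycle hρ, prod_singleton, sub_eq_zero] at hterm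
    have hq : ∀ i, (fun ax => (m ax).succAbove (act τ' (diag (rep ρ i)) ax)) = fun ax => (m ax).succAbove (q ax) := by
      intro i
      funext ax
      simp only [rep_eq_zero_of_forall_sameCycle hρ, act, diag, hτ', swap_apply_left]
    simp only [hq] at hterm
    exact mem_of_prod_setInd_eq_one hterm.symm (mem_univ i)
  · intro h
    refine sum_eq_zero fun τ' _ => sum_eq_zero fun ρ _ => ?_
    refine prod_eq_zero (orbit_mem_orbits ρ 0) ?_
    rw [sub_eq_zero, eq_comm]
    exact prod_eq_one fun i _ => by rw [setInd_apply, if_pos (h _ i)]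

/-- The charge at a point of the meet is STRICTLY positive iff some point of the link misses some `a_i`. [this work] -/
theorem pinned_pos_iff_of_mem (a : Fin (N + 1) → Finset (Q d (N + 2))) {m : Q d (N + 2)} (hm : ∀ i, m ∈ a i) :
    0 < patternForm d (N + 2) (Fin.cons (setInd {m}) (fun i => setInd (a i)) : Fin (N + 2) → Q d (N + 2) → ℝ) ↔
      ∃ (q : Q d (N + 1)) (i : Fin (N + 1)), (fun ax => (m ax).succAbove (q ax)) ∉ a i := by
  rw [(pinned_nonneg_of_mem a hm).lt_iff_ne, ne_comm, Ne, pinned_eq_zero_iff_of_mem a hm]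
  simp only [not_forall]

/-- For up-sets, the zero set of the charge on the meet is a down-set of the meet. [this work] -/
theorem pinned_eq_zero_of_le (a : Fin (N + 1) → Finset (Q d (N + 2))) (ha : ∀ i, IsUpperSet ((a i : Finset (Q d (N + 2))) : Set (Q d (N + 2))))
    {m m' : Q d (N + 2)} (hmm' : m ≤ m') (hm : ∀ i, m ∈ a i)
    (h0 : patternForm d (N + 2) (Fin.cons (setInd {m'}) (fun i => setInd (a i)) : Fin (N + 2) → Q d (N + 2) → ℝ) = 0) :
    patternForm d (N + 2) (Fin.cons (setInd {m}) (fun i => setInd (a i)) : Fin (N + 2) → Q d (N + 2) → ℝ) = 0 :=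
  le_antisymm (h0 ▸ pinned_mono_of_mem a ha hmm' hm) (pinned_nonneg_of_mem a hm)

end SahiSlot

end Summit.CriticalPhenomena.PercolationContinuityZ3.Theorems
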